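import Summits.Ventures.LatticeQCDFlow.Exactness.AcceptanceFromMeanEnergyViolation
import Summits.Ventures.LatticeQCDFlow.Exactness.NCMCGeneralSpacePinskerFloor
import Summits.Ventures.LatticeQCDFlow.Exactness.Phi4LocalMetropolisExact
import HarnessLib

/-!
# The single-site Metropolis update IS a volume-preserving involution on (step, configuration) space;
# hence its acceptance is floored by the mean proposed action increase: `1 − ⟨a_x⟩ ≤ √(1 − e^{−⟨ΔS_x⟩})`

HONEST FRAMING: exact (Metropolis-corrected) sampling algorithms for lattice gauge theory;
figures of merit are autocorrelation/cost numbers at stated couplings and volumes; no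
continuum-physics claim.  (SCALAR calibration rung S0-A: not a gauge result.)

Venture `LatticeQCDFlow` (cell pub-lqcd), topic `Exactness`; FANOUT row 2 (`s0-phi4`, LOCAL arm: the
single-site random-walk Metropolis update `metroSite J λ ρ x` of `Phi4LocalMetropolisExact`).  NEW WORK
of the cell (Mathlib's `MeasurePreserving.skew_product`; nothing is cited as a fact).  Row 2's
`AcceptanceFromMeanEnergyViolation` typed, for HMC, that a measurable `μ`-preserving INVOLUTION `Ψ`
with weight `e^{−H}` has equilibrium acceptance `⟨min(1, e^{−ΔH})⟩ ≥ 1 − √(1 − e^{−⟨ΔH⟩})`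
(Bretagnolle–Huber form; `ΔH e^{−H} ∈ L¹`).  Here the LOCAL arm is put in the same frame: on
`X = ℝ × ℝ^Λ` with Lebesgue measure the map `Ψ_x(u, φ) = (−u, φ + u·e_x)` is a measurable,
measure-preserving involution (a shear followed by a reflection), and with `H(u, φ) = S(φ) − log ρ(u)`
for an EVEN positive step density `ρ` one has `e^{−H} = e^{−S(φ)} ρ(u)` and
`ΔH = S(φ + u e_x) − S(φ) = ΔS_x` — the proposal's log-density cancels by symmetry, which is why
random-walk Metropolis needs no Hastings ratio.  Consequently EVERY involution theorem of the tree
applies to the site update: Creutz / the fluctuation relation (`Phi4HMCFluctuationRelation`), the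
Bretagnolle–Huber acceptance floor (typed below), and the Pinsker floor `1 − ⟨a_x⟩ ≤ √(⟨ΔS_x⟩/2)` of
the sibling `AcceptanceFromMeanEnergyViolationPinsker` (same session; its abstract
`involutive_acceptance_ge_pinsker` applies verbatim to `Ψ_x` — drawn in a sequel once both are built).

## What is proved (`Λ = Fin (n+1)`, site `x`; no definition is introduced, the map is written inline)

* `siteShear_involutive` (`Ψ_x ∘ Ψ_x = id`), `measurable_single_fst`, `measurable_siteShear`,
  **`measurePreserving_siteShear`** (Lebesgue on `ℝ × ℝ^Λ`: skew product of `u ↦ −u` with the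
  translations `φ ↦ φ + u e_x`);
* `deltaH_site_eq` — `H(u, φ) = S(φ) − log ρ(u)`, `ρ` even ⇒ `deltaH H Ψ_x (u, φ) = S(φ + u e_x) − S(φ)`;
  `exp_neg_H_site` — `e^{−H} = e^{−S(φ)} ρ(u)` (`ρ > 0`); `metroAccept_update_eq` —
  `metroAccept J λ x φ (φ_x + u) = min(1, e^{−ΔS_x(u, φ)})` (`Function.update φ x (φ_x + u) = φ + u e_x`);
* **`metropolisSite_acceptance_ge`** — `S` measurable with `e^{−S}` integrable; `ρ > 0` even measurable,
  `∫ ρ = 1`; the first moment `ΔS_x · e^{−S(φ)} ρ(u) ∈ L¹(du dφ)` (hypothesis):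
  `∫∫ min(1, e^{−ΔS_x}) ρ(u) e^{−S(φ)} du dφ ≥ (1 − √(1 − e^{−⟨ΔS_x⟩})) · Z`,
  `⟨ΔS_x⟩ = Z⁻¹ ∫∫ (S(φ + u e_x) − S(φ)) ρ(u) e^{−S(φ)}`, `Z = ∫ e^{−S}` (`∫ ρ = 1` makes the joint
  normalisation `Z`); the inner `u`-integral is the acceptance probability `a_x(φ)` of the tree's
  `metroSite` from `φ` after `t' = φ_x + u`;
* **`phi4MetropolisSite_acceptance_ge`** — lattice φ⁴ (`λ > 0`, real `J`), every site, every positive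
  even step density (e.g. Gaussian steps): the same with `Z = gibbsZ J λ`;
* `sqrt_one_sub_exp_neg_le_sqrt`, Cauchy–Schwarz for square roots (inline), and
  **`metropolisScan_acceptance_ge`** — summed over any finite set of sites `s` (the random scan over
  `s`): `Σ_{x∈s} acceptance_x ≥ (|s| − √(|s| Σ_x ⟨ΔS_x⟩))·Z`, i.e. SCAN ACCEPTANCE `≥ 1 − √(m̄)`,
  `m̄ = |s|⁻¹ Σ_x ⟨ΔS_x⟩` the scan's mean proposed action increase.

Reading for S0-A (no numerics implied): the local arm's acceptance column is certified from below by
the measured mean proposed action increase `⟨ΔS_x⟩` (model-free, every step law), exactly as the HMC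
arm's is by `⟨ΔH⟩`.  NOT CLAIMED: the first-moment integrability for the φ⁴ action (true for steps
with a fourth moment — polynomial growth —, left as the hypothesis `hΔ`, as `hmc_acceptance_ge` first
did for HMC); compactly supported window densities (the frame needs `ρ > 0`); the sweep / scan
(their acceptance is the average of the `a_x`); any value for any run.
-/

namespace Summit.Ventures.LatticeQCDFlow.Exactness

open Real MeasureTheory Filter
open Summit.Ventures.LatticeQCDFlow.Scoring

section Site

variable {n : ℕ}

/-- The site shear-and-flip `Ψ_x(u, φ) = (−u, φ + u·e_x)` is an involution. -/
theorem siteShear_involutive (x : Fin (n + 1)) :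
    Function.Involutive (fun p : ℝ × (Fin (n + 1) → ℝ) => (-p.1, p.2 + Pi.single x p.1)) := by
  intro p
  ext
  · simp
  · simp only
    rw [add_assoc, ← Pi.single_add, add_neg_cancel, Pi.single_zero, add_zero]

/-- `(u, φ) ↦ u·e_x` is measurable. -/
theorem measurable_single_fst (x : Fin (n + 1)) :
    Measurable (fun p : ℝ × (Fin (n + 1) → ℝ) => (Pi.single x p.1 : Fin (n + 1) → ℝ)) := by
  refine measurable_pi_iff.2 fun i => ?_
  by_cases h : i = x
  · subst h
    simp only [Pi.single_eq_same]
    exact measurable_fst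
  · simp only [Pi.single_apply, h, if_false]
    exact measurable_const

/-- Measurability of `Ψ_x`. -/
theorem measurable_siteShear (x : Fin (n + 1)) :
    Measurable (fun p : ℝ × (Fin (n + 1) → ℝ) => (-p.1, p.2 + Pi.single x p.1)) :=
  (measurable_fst.neg).prodMk (measurable_snd.add (measurable_single_fst x))

/-- **`Ψ_x` preserves Lebesgue measure on `ℝ × ℝ^Λ`** (skew product of the reflection `u ↦ −u` with
the translations `φ ↦ φ + u e_x`). -/
theorem measurePreserving_siteShear (x : Fin (n + 1)) :
    MeasurePreserving (fun p : ℝ × (Fin (n + 1) → ℝ) => (-p.1, p.2 + Pi.single x p.1))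
      ((volume : Measure ℝ).prod (volume : Measure (Fin (n + 1) → ℝ)))
      ((volume : Measure ℝ).prod (volume : Measure (Fin (n + 1) → ℝ))) := by
  have hneg : MeasurePreserving (fun u : ℝ => -u) volume volume := Measure.measurePreserving_neg volume
  have hgm : Measurable (Function.uncurry fun (u : ℝ) (φ : Fin (n + 1) → ℝ) => φ + Pi.single x u) :=
    measurable_snd.add (measurable_single_fst x)
  exact MeasurePreserving.skew_product (μc := (volume : Measure (Fin (n + 1) → ℝ)))
    (μd := (volume : Measure (Fin (n + 1) → ℝ))) hneg hgm
    (Eventually.of_forall fun u =>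
      (measurePreserving_add_right (volume : Measure (Fin (n + 1) → ℝ))
        (Pi.single x u : Fin (n + 1) → ℝ)).map_eq)

/-- With `H(u, φ) = S(φ) − log ρ(u)` and `ρ` even, the energy violation of `Ψ_x` is the proposed
action increase: `ΔH(u, φ) = S(φ + u e_x) − S(φ)`. -/
theorem deltaH_site_eq (S : (Fin (n + 1) → ℝ) → ℝ) {ρ : ℝ → ℝ} (hρs : ∀ u, ρ (-u) = ρ u)
    (x : Fin (n + 1)) (p : ℝ × (Fin (n + 1) → ℝ)) :
    deltaH (fun q : ℝ × (Fin (n + 1) → ℝ) => S q.2 - Real.log (ρ q.1))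
        (fun q => (-q.1, q.2 + Pi.single x q.1)) p
      = S (p.2 + Pi.single x p.1) - S p.2 := by
  unfold deltaH
  simp only [hρs]
  ring

/-- `e^{−H(u, φ)} = e^{−S(φ)} ρ(u)` for `ρ > 0`. -/
theorem exp_neg_H_site (S : (Fin (n + 1) → ℝ) → ℝ) {ρ : ℝ → ℝ} (hρ0 : ∀ u, 0 < ρ u)
    (p : ℝ × (Fin (n + 1) → ℝ)) :
    Real.exp (-(S p.2 - Real.log (ρ p.1))) = Real.exp (-S p.2) * ρ p.1 := by
  rw [show -(S p.2 - Real.log (ρ p.1)) = -S p.2 + Real.log (ρ p.1) by ring, Real.exp_add,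
    Real.exp_log (hρ0 _)]

/-- `metroAccept` at the proposal `φ_x + u` is `min(1, e^{−ΔS_x(u, φ)})` with `ΔS_x` the energy violation
of `Ψ_x` (`Function.update φ x (φ x + u) = φ + u e_x`). -/
theorem metroAccept_update_eq (J : Fin (n + 1) → Fin (n + 1) → ℝ) (lam : ℝ) (x : Fin (n + 1))
    (φ : Fin (n + 1) → ℝ) (u : ℝ) :
    metroAccept J lam x φ (φ x + u)
      = min 1 (Real.exp (-(latticePhi4Action J lam (φ + Pi.single x u) - latticePhi4Action J lam φ))) := by
  rw [metroAccept_eq_exp]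
  have e : Function.update φ x (φ x + u) = φ + Pi.single x u := by
    ext i
    by_cases h : i = x
    · subst h; simp
    · simp [h]
  rw [e]

/-- **THE SITE-METROPOLIS ACCEPTANCE FLOOR (Bretagnolle–Huber form), GENERAL ACTION**: `S` measurable
with `e^{−S}` integrable and `Z = ∫ e^{−S} > 0`; `ρ > 0` even measurable with `∫ ρ = 1`; the first moment
`(S(φ + u e_x) − S(φ)) ρ(u) e^{−S(φ)} ∈ L¹(du dφ)`.  Then
`∫∫ min(1, e^{−ΔS_x}) ρ(u) e^{−S(φ)} ≥ (1 − √(1 − e^{−⟨ΔS_x⟩})) · Z`,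
`⟨ΔS_x⟩ = Z⁻¹ ∫∫ ΔS_x ρ e^{−S}` — the tree's `involutive_acceptance_ge` on the site involution. -/
theorem metropolisSite_acceptance_ge {S : (Fin (n + 1) → ℝ) → ℝ} (hSm : Measurable S)
    (hSi : Integrable (fun φ => Real.exp (-S φ))) {ρ : ℝ → ℝ} (hρ0 : ∀ u, 0 < ρ u)
    (hρm : Measurable ρ) (hρs : ∀ u, ρ (-u) = ρ u) (hρ1 : ∫ u, ρ u = 1) (x : Fin (n + 1))
    (hΔ : Integrable (fun p : ℝ × (Fin (n + 1) → ℝ) =>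
      (S (p.2 + Pi.single x p.1) - S p.2) * (Real.exp (-S p.2) * ρ p.1))
      ((volume : Measure ℝ).prod (volume : Measure (Fin (n + 1) → ℝ)))) :
    (1 - Real.sqrt (1 - Real.exp (-((∫ p, (S (p.2 + Pi.single x p.1) - S p.2)
        * (Real.exp (-S p.2) * ρ p.1) ∂((volume : Measure ℝ).prod (volume : Measure (Fin (n + 1) → ℝ))))
        / ∫ φ, Real.exp (-S φ)))))
      * ∫ φ, Real.exp (-S φ)
      ≤ ∫ p, min 1 (Real.exp (-(S (p.2 + Pi.single x p.1) - S p.2))) * (Real.exp (-S p.2) * ρ p.1)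
          ∂((volume : Measure ℝ).prod (volume : Measure (Fin (n + 1) → ℝ))) := by
  set μ2 : Measure (ℝ × (Fin (n + 1) → ℝ)) :=
    (volume : Measure ℝ).prod (volume : Measure (Fin (n + 1) → ℝ)) with hμ2
  set H : ℝ × (Fin (n + 1) → ℝ) → ℝ := fun q => S q.2 - Real.log (ρ q.1) with hH
  set Ψ : ℝ × (Fin (n + 1) → ℝ) → ℝ × (Fin (n + 1) → ℝ) := fun q => (-q.1, q.2 + Pi.single x q.1) with hΨ
  have hHm : Measurable H := (hSm.comp measurable_snd).sub ((Real.measurable_log.comp hρm).comp measurable_fst)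
  -- the weight `e^{−H} = e^{−S} ρ` and its integral `Z · 1`
  have hexpH : ∀ q, Real.exp (-H q) = Real.exp (-S q.2) * ρ q.1 := fun q => exp_neg_H_site S hρ0 q
  have hρi : Integrable ρ := by
    by_contra h
    rw [integral_undef h] at hρ1
    exact zero_ne_one hρ1
  have hw : Integrable (fun q => Real.exp (-H q)) μ2 := by
    simp_rw [hexpH]
    have h := (hρi.mul_prod hSi : Integrable (fun q : ℝ × (Fin (n + 1) → ℝ) => ρ q.1 * Real.exp (-S q.2)) μ2)
    exact h.congr (Eventually.of_forall fun q => by ring)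
  have hZeq : ∫ q, Real.exp (-H q) ∂μ2 = ∫ φ, Real.exp (-S φ) := by
    simp_rw [hexpH]
    have h := integral_prod_mul (μ := (volume : Measure ℝ)) (ν := (volume : Measure (Fin (n + 1) → ℝ)))
      ρ (fun φ => Real.exp (-S φ))
    rw [show (fun q : ℝ × (Fin (n + 1) → ℝ) => Real.exp (-S q.2) * ρ q.1)
        = fun q => ρ q.1 * Real.exp (-S q.2) from funext fun q => mul_comm _ _, h, hρ1, one_mul]
  have hZ : 0 < ∫ q, Real.exp (-H q) ∂μ2 := by rw [hZeq]; exact integral_exp_pos hSi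
  -- `ΔH = ΔS_x`
  have hΔH : ∀ q, deltaH H Ψ q = S (q.2 + Pi.single x q.1) - S q.2 := fun q => deltaH_site_eq S hρs x q
  have hΔ' : Integrable (fun q => deltaH H Ψ q * Real.exp (-H q)) μ2 :=
    hΔ.congr (Eventually.of_forall fun q => by simp only [hΔH, hexpH])
  have key := involutive_acceptance_ge hHm (measurable_siteShear x) (siteShear_involutive x)
    (measurePreserving_siteShear x) hw hΔ' hZ
  -- rewrite every `H`-expression back into `S`, `ρ`
  have e1 : ∫ q, deltaH H Ψ q * Real.exp (-H q) ∂μ2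
      = ∫ q, (S (q.2 + Pi.single x q.1) - S q.2) * (Real.exp (-S q.2) * ρ q.1) ∂μ2 :=
    integral_congr_ae (Eventually.of_forall fun q => by simp only [hΔH, hexpH])
  have e2 : ∫ q, min 1 (Real.exp (-deltaH H Ψ q)) * Real.exp (-H q) ∂μ2
      = ∫ q, min 1 (Real.exp (-(S (q.2 + Pi.single x q.1) - S q.2))) * (Real.exp (-S q.2) * ρ q.1) ∂μ2 :=
    integral_congr_ae (Eventually.of_forall fun q => by simp only [hΔH, hexpH])
  rw [e1, e2, hZeq] at key
  exact key

/-- **THE SITE-METROPOLIS ACCEPTANCE FLOOR FOR LATTICE φ⁴** (`λ > 0`, real `J`, every site `x`, every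
positive even step density `ρ` with `∫ ρ = 1`; the first moment of `ΔS_x` as hypothesis):
`∫∫ min(1, e^{−ΔS_x}) ρ(u) e^{−S(φ)} du dφ ≥ (1 − √(1 − e^{−⟨ΔS_x⟩})) · Z` — the inner integral being
the acceptance probability `a_x(φ)` of row 2's `metroSite J λ ρ x` (`metroAccept_update_eq`). -/
theorem phi4MetropolisSite_acceptance_ge {lam : ℝ} (hlam : 0 < lam)
    (J : Fin (n + 1) → Fin (n + 1) → ℝ) {ρ : ℝ → ℝ} (hρ0 : ∀ u, 0 < ρ u) (hρm : Measurable ρ)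
    (hρs : ∀ u, ρ (-u) = ρ u) (hρ1 : ∫ u, ρ u = 1) (x : Fin (n + 1))
    (hΔ : Integrable (fun p : ℝ × (Fin (n + 1) → ℝ) =>
      (latticePhi4Action J lam (p.2 + Pi.single x p.1) - latticePhi4Action J lam p.2)
        * (gibbsWeight J lam p.2 * ρ p.1))
      ((volume : Measure ℝ).prod (volume : Measure (Fin (n + 1) → ℝ)))) :
    (1 - Real.sqrt (1 - Real.exp (-((∫ p, (latticePhi4Action J lam (p.2 + Pi.single x p.1)
        - latticePhi4Action J lam p.2) * (gibbsWeight J lam p.2 * ρ p.1)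
          ∂((volume : Measure ℝ).prod (volume : Measure (Fin (n + 1) → ℝ)))) / gibbsZ J lam))))
      * gibbsZ J lam
      ≤ ∫ p, min 1 (Real.exp (-(latticePhi4Action J lam (p.2 + Pi.single x p.1)
          - latticePhi4Action J lam p.2))) * (gibbsWeight J lam p.2 * ρ p.1)
          ∂((volume : Measure ℝ).prod (volume : Measure (Fin (n + 1) → ℝ))) :=
  metropolisSite_acceptance_ge (continuous_latticePhi4Action J lam).measurable (integrable_gibbsWeight hlam J)
    hρ0 hρm hρs hρ1 x hΔ

/-! ## The scan: averaging the site floors (Cauchy–Schwarz) -/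

/-- `√(1 − e^{−m}) ≤ √m` (`1 − m ≤ e^{−m}` for every real `m`). -/
theorem sqrt_one_sub_exp_neg_le_sqrt (m : ℝ) :
    Real.sqrt (1 - Real.exp (-m)) ≤ Real.sqrt m :=
  Real.sqrt_le_sqrt (by linarith [Real.add_one_le_exp (-m)])

/-- **THE SCAN'S ACCEPTANCE FLOOR FROM THE MEAN PROPOSED ACTION INCREASE** (general action `S` with
`e^{−S}` integrable, `ρ > 0` even with `∫ ρ = 1`, every site's first moment integrable): summing the
site floors over any finite set of sites `s` (the random scan over `s` accepts with the AVERAGE of the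
site acceptances), with `m_x = ⟨ΔS_x⟩ ≥ 0` (Creutz):
`Σ_{x∈s} ∫∫ min(1, e^{−ΔS_x}) ρ e^{−S} ≥ (|s| − √(|s| · Σ_{x∈s} m_x)) · Z`, i.e. dividing by `|s| Z`:
**scan acceptance `≥ 1 − √(m̄)`**, `m̄ = |s|⁻¹ Σ_x ⟨ΔS_x⟩` the scan's mean proposed action increase
(Bretagnolle–Huber `≤ √m` per site, then Cauchy–Schwarz; the Pinsker constant `√(m̄/2)` follows the
same way from the sibling's site floor). -/
theorem metropolisScan_acceptance_ge {S : (Fin (n + 1) → ℝ) → ℝ} (hSm : Measurable S)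
    (hSi : Integrable (fun φ => Real.exp (-S φ))) {ρ : ℝ → ℝ} (hρ0 : ∀ u, 0 < ρ u)
    (hρm : Measurable ρ) (hρs : ∀ u, ρ (-u) = ρ u) (hρ1 : ∫ u, ρ u = 1) (s : Finset (Fin (n + 1)))
    (hΔ : ∀ x ∈ s, Integrable (fun p : ℝ × (Fin (n + 1) → ℝ) =>
      (S (p.2 + Pi.single x p.1) - S p.2) * (Real.exp (-S p.2) * ρ p.1))
      ((volume : Measure ℝ).prod (volume : Measure (Fin (n + 1) → ℝ))))
    (hm0 : ∀ x ∈ s, 0 ≤ (∫ p, (S (p.2 + Pi.single x p.1) - S p.2) * (Real.exp (-S p.2) * ρ p.1)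
      ∂((volume : Measure ℝ).prod (volume : Measure (Fin (n + 1) → ℝ)))) / ∫ φ, Real.exp (-S φ)) :
    ((s.card : ℝ) - Real.sqrt (s.card * ∑ x ∈ s,
        (∫ p, (S (p.2 + Pi.single x p.1) - S p.2) * (Real.exp (-S p.2) * ρ p.1)
          ∂((volume : Measure ℝ).prod (volume : Measure (Fin (n + 1) → ℝ)))) / ∫ φ, Real.exp (-S φ)))
      * ∫ φ, Real.exp (-S φ)
      ≤ ∑ x ∈ s, ∫ p, min 1 (Real.exp (-(S (p.2 + Pi.single x p.1) - S p.2)))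
          * (Real.exp (-S p.2) * ρ p.1) ∂((volume : Measure ℝ).prod (volume : Measure (Fin (n + 1) → ℝ))) := by
  set Z : ℝ := ∫ φ, Real.exp (-S φ) with hZdef
  set m : Fin (n + 1) → ℝ := fun x => (∫ p, (S (p.2 + Pi.single x p.1) - S p.2)
      * (Real.exp (-S p.2) * ρ p.1) ∂((volume : Measure ℝ).prod (volume : Measure (Fin (n + 1) → ℝ)))) / Z
    with hmdef
  have hZ : 0 < Z := integral_exp_pos hSi
  -- per site: `(1 − √m_x) Z ≤ acceptance_x`
  have hsite : ∀ x ∈ s, (1 - Real.sqrt (m x)) * Z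
      ≤ ∫ p, min 1 (Real.exp (-(S (p.2 + Pi.single x p.1) - S p.2))) * (Real.exp (-S p.2) * ρ p.1)
          ∂((volume : Measure ℝ).prod (volume : Measure (Fin (n + 1) → ℝ))) := by
    intro x hx
    have h := metropolisSite_acceptance_ge hSm hSi hρ0 hρm hρs hρ1 x (hΔ x hx)
    refine le_trans ?_ h
    have hs := sqrt_one_sub_exp_neg_le_sqrt (m x)
    exact mul_le_mul_of_nonneg_right (by linarith) hZ.le
  have hsum := Finset.sum_le_sum hsite
  refine le_trans ?_ hsum
  rw [← Finset.sum_mul, Finset.sum_sub_distrib, Finset.sum_const, nsmul_eq_mul, mul_one]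
  -- Cauchy–Schwarz for square roots: `Σ_x √(m_x) ≤ √(|s| · Σ_x m_x)`
  have hcs : ∑ x ∈ s, Real.sqrt (m x) ≤ Real.sqrt (s.card * ∑ x ∈ s, m x) := by
    have h := Finset.sum_mul_sq_le_sq_mul_sq s (fun _ => (1:ℝ)) (fun x => Real.sqrt (m x))
    simp only [one_pow, Finset.sum_const, nsmul_eq_mul, mul_one, one_mul] at h
    have e : ∑ x ∈ s, Real.sqrt (m x) ^ 2 = ∑ x ∈ s, m x :=
      Finset.sum_congr rfl fun x hx => Real.sq_sqrt (hm0 x hx)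
    rw [e] at h
    have h0 : 0 ≤ ∑ x ∈ s, Real.sqrt (m x) := Finset.sum_nonneg fun x _ => Real.sqrt_nonneg _
    calc ∑ x ∈ s, Real.sqrt (m x) = Real.sqrt ((∑ x ∈ s, Real.sqrt (m x)) ^ 2) := by
          rw [Real.sqrt_sq h0]
      _ ≤ Real.sqrt (s.card * ∑ x ∈ s, m x) := Real.sqrt_le_sqrt h
  exact mul_le_mul_of_nonneg_right (by linarith [hcs]) hZ.le

end Site

end Summit.Ventures.LatticeQCDFlow.Exactness
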